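import Literature.Combinatorics.Optimization.PsdRankFidelityLowerBounds
import Literature.Combinatorics.Optimization.PsdLiftSlackMatrix
import Mathlib.Data.Fin.Tuple.Sort
import Mathlib.NumberTheory.Harmonic.Bounds
import HarnessLib

/-!
# Lee–Wei–de Wolf's bounding functionals are polynomial in the rank: `B₂ ≤ rank` (mutual information),
# `B₃ ≤ (ln m + 1)² rank²`, `B₄ ≤ rank`, `B₅ ≤ rank²(ln m + 1)` (Riazanov–Vyalyi 2017, §4: Theorems 4.1–4.4,
# Lemmas 4.1–4.4) — PROVED

Source: A. Riazanov, M. Vyalyi, *Exploring the bounds on the positive semidefinite rank*,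
arXiv:1704.06507 (2017) [RiazanovVyalyiy2017]; held text `paper:arxiv-1704.06507`, p05–p08 (`pNN` =
held-text chunk). Context: the lower-bound functionals `B₂,…,B₅` of Lee–Wei–de Wolf [LeeWeiDeWolf2017]
(the tree's `PsdRankFidelityLowerBounds.lean`: `LeeWeiDeWolf2017_thm24_real` is `B₄ ≤ rank_psd`); the
paper shows "these functionals cannot give exponential bounds on the PSD-rank" (p03): each is bounded by
a polynomial in the ordinary rank and `log` of the size, and `rank S_P = dim P + 1` for slack matrices.

Printed statements (verbatim). (p05) "Recall that the left stochastic matrix is the matrix with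
nonnegative entries, with each column summing to `1` … Fact 3.3. Let `M ∈ ℝ^{n×m}` be a stochastic
matrix. Then `rank_psd M ≥ B₄(M) = Σ_{i=1}^n max_j M(i,j)`." (p06, §4.1 Row elimination transformation)
"Let `M ∈ ℝ^{n×m}` be a nonnegative matrix with `rank M = r < n`. Without loss of generality, assume
that first `r+1` rows `m_1, …, m_{r+1}` are non-zero. They are linearly dependent, so there exists a
nontrivial set of real numbers `{α_i}` such that `Σ α_i m_i = 0`. Since all entries of `M` are nonnegative,
there are both negative and positive numbers among `{α_i}` … `Δ_α = [−1/max_i α_i, −1/min_i α_i]` … the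
`i`-th row of `M^ε` equals `m_i(1 + εα_i)` … for `ε ∈ Δ_α` the matrix `M^ε` is nonnegative matrix, and
when `ε` is either the left or the right end of `Δ_α`, `M^ε` has more zero rows than `M`. … sums of
columns do not change after row elimination transformation". (p08) "**Theorem 4.3.** Let `M ∈ ℝ^{n×m}`
be a stochastic matrix, `rank M = r`. Then `B₄(M) ≤ r`." (proof: `B₄(M^ε) − B₄(M) = ε·Λ` is linear in
`ε`, so at one end of `Δ_α` it is nonnegative while `M^ε` has fewer non-zero rows; iterate down to at
most `r` non-zero rows, each contributing `max_j ≤ 1`.) (p06) "`I(X : Y) = … = Σ_i Σ_j m_ij log₂(m_ij/(p_i q_j))`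
… `I(M) = I(X:Y)`. **Theorem 4.1.** Let `M ∈ ℝ^{n×m}` be the matrix of a joint distribution of `X` and
`Y`. Then `B₂(M) = 2^{I(X:Y)} ≤ rank M`." (proof: `I(M^ε) − I(M) = ε·Λ`; then
`I(M̃) ≤ H(X̃) ≤ log|supp(X̃)| ≤ log r`.) (p07) "**Theorem 4.2.** Let `M ∈ ℝ^{n×m}` be a stochastic matrix,
`rank M = r`. Then `B₃(M) ≤ (ln m + 1)² r²`" with "**Lemma 4.1.** For distributions `p, q` it holds
`F(p,q) ≥ 1 − |p − q|/2`", "**Lemma 4.2.** There exists `s` such that `s q_s ≥ 1/(ln m + 1)`" (for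
`q_1 ≥ … ≥ q_m`), "**Lemma 4.3.** … there exists a stochastic matrix `M̃ ∈ ℝ^{r×m}` such that
`S(M) ≤ S(M̃)`" (`S(M) = ½Σ_{i,j}|M_i − M_j|/m²`, row elimination), "**Lemma 4.4.** Let `M ∈ ℝ^{r×m}` be a
stochastic matrix. Then `S(M) ≤ 1 − 1/r`." (p08) "**Theorem 4.4.** Let `M ∈ ℝ^{n×m}` be a stochastic
matrix, `rank M = r`. Then `B₅(M) ≤ r²(ln m + 1)`."

## Contents (all PROVED; no named facts)

* `exists_rowElimination` — §4.1 in one step: for a nonnegative `M` whose nonzero rows are linearly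
  dependent and any row weights `w`, there are multipliers `d_i = 1 + εα_i ≥ 0` preserving all column
  sums, not decreasing `Σ_i d_i w_i` relative to `Σ_i w_i`, and killing a nonzero row.
* **`RiazanovVyalyiy2017_thm43`** — Theorem 4.3 with `max_j` as an arbitrary column selection `c` (the
  tree's form of `B₄`, cf. `LeeWeiDeWolf2017_thm24_real`): for a column-stochastic `M`,
  `Σ_i M(i, c(i)) ≤ rank M`; `RiazanovVyalyiy2017_thm43_le_min` — together with LWdW Theorem 24,
  `B₄ ≤ min(rank, rank_psd^ℝ)`.
* Appended: `rowMarginal`, `colMarginal`, `rowMutualInfo`, `mutualInfo` (`I(M)` with natural `log`),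
  `mutualInfo_le_entropy` (`I ≤ H(X)`), `sum_negMulLog_le_log_card` (`H ≤ log|supp|`, Jensen),
  `rowMutualInfo_rowScale` (`I(M^ε) − I(M) = εΛ`), **`RiazanovVyalyiy2017_thm41`** (`I(M) ≤ log rank M`)
  and `RiazanovVyalyiy2017_thm41_exp` (`exp I(M) ≤ rank M`, the printed `2^{I₂} ≤ rank`).
* Appended: `colL1Dist`, **`RiazanovVyalyiy2017_lemma41`** (`F ≥ 1 − ½|p − q|₁`), `rowL1Spread` (row terms
  of `Z(M)`), `rowL1Spread_rowScale`, `sum_rowL1Spread_le_of_support` (Lemma 4.4 by a shorter road: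
  `min(a,b) ≥ ab` on `[0,1]` and Cauchy–Schwarz instead of the printed sorting/maximisation),
  **`RiazanovVyalyiy2017_lemma43_44`** (`Z(M) ≤ m²(1 − 1/rank M)`), `sum_fidelity_ge_sq_div_rank`
  (`Σ_{s,t} F(M_s,M_t) ≥ m²/rank M`), **`RiazanovVyalyiy2017_lemma42`** (top-`s` columns with
  `q ≥ 1/((ln m+1)s)`, via `Tuple.sort` and `harmonic_le_one_add_log`), **`RiazanovVyalyiy2017_thm42`**
  (`1 ≤ (ln m + 1)² (rank M)² Σ_{s,t} q_s q_t F(M_s,M_t)²`, the form of `LeeWeiDeWolf2017_thm19_real`).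
* Appended: **`RiazanovVyalyiy2017_thm44`** (`B₅ ≤ (rank M)²(ln m + 1)`, the form of
  `LeeWeiDeWolf2017_thm29_real`: Theorem 4.2 on each denominator, `Σ_k q_k M(i,k) ≤ max_k M(i,k)`, Theorem 4.3).
* Appended — the paper's conclusion for polytopes (p03: "Since for any polytope `P` we have
  `rank S_P = dim(P) + 1`, it would mean that the bounds are polynomial in the dimension of the polytope"):
  `RiazanovVyalyiy2017_slack_B4` / `_B2` / `_B3` / `_B5` — for the column-normalised slack matrix of a
  `V`/`H`-described `n`-polytope with `f` facet inequalities, `B₄ ≤ n+1`, `I ≤ log(n+1)`,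
  `B₃ ≤ (ln f+1)²(n+1)²`, `B₅ ≤ (n+1)²(ln f+1)` (with the tree's `rank_pairSlackMatrix_eq_finrank_add_one`).
-/

noncomputable section

open Matrix Finset

namespace Literature.Combinatorics.Optimization

section RowElimination

variable {n m : ℕ}

/-- The rows of a real matrix span a space of dimension `rank`; a linearly independent family of rows
has at most `rank M` members. [cite: RiazanovVyalyiy2017, §4.1 (p06, "rank M = r < n … first r+1 rows …
are linearly dependent")] -/
theorem card_le_rank_of_linearIndependent_rows (M : Matrix (Fin n) (Fin m) ℝ) {s : Finset (Fin n)}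
    (hli : LinearIndependent ℝ (fun i : s => M i.1)) : s.card ≤ M.rank := by
  classical
  have h1 : Module.finrank ℝ (Submodule.span ℝ (Set.range fun i : s => M i.1)) = s.card := by
    rw [finrank_span_eq_card hli, Fintype.card_coe]
  have h2 : Submodule.span ℝ (Set.range fun i : s => M i.1) ≤
      Submodule.span ℝ (Set.range fun i : Fin n => M i) := by
    apply Submodule.span_mono
    rintro _ ⟨i, rfl⟩
    exact ⟨i.1, rfl⟩
  have hcolM : Mᵀ.col = fun i : Fin n => M i := by funext i j; rfl
  have h3 : M.rank = Module.finrank ℝ (Submodule.span ℝ (Set.range fun i : Fin n => M i)) := by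
    rw [← Matrix.rank_transpose, Matrix.rank_eq_finrank_span_cols, hcolM]
  rw [h3, ← h1]
  exact Submodule.finrank_mono h2

/-- **The row elimination transformation** (§4.1): if the nonzero rows of a nonnegative `M` are linearly
dependent (`Σ α_i m_i = 0`, `α ≢ 0`; then `α` takes both signs), then at the appropriate end `ε` of
`Δ_α = [−1/max α_i, −1/min α_i]` the multipliers `d_i = 1 + εα_i ≥ 0` preserve every column sum, do not
decrease a given linear functional `Σ_i d_i w_i ≥ Σ_i w_i` of the rows (the sign of `ε` is chosen by the
sign of `Λ = Σ α_i w_i`), and annihilate some nonzero row. [cite: RiazanovVyalyiy2017, §4.1 (p06) and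
Thm. 4.3 proof (p08)] -/
theorem exists_rowElimination (M : Matrix (Fin n) (Fin m) ℝ) (hM : ∀ i j, 0 ≤ M i j) {s : Finset (Fin n)}
    (hs : ∀ i, i ∈ s ↔ M i ≠ 0) (hdep : ¬ LinearIndependent ℝ (fun i : s => M i.1)) (w : Fin n → ℝ) :
    ∃ d : Fin n → ℝ, (∀ i, 0 ≤ d i) ∧ (∀ j, ∑ i, d i * M i j = ∑ i, M i j) ∧
      (∑ i, w i ≤ ∑ i, d i * w i) ∧ ∃ i, i ∈ s ∧ d i = 0 := by
  classical
  rw [Fintype.not_linearIndependent_iff] at hdep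
  obtain ⟨g, hg0, ⟨i₁, hi₁⟩⟩ := hdep
  -- the relation, coordinatewise
  have hrel : ∀ j, ∑ i : s, g i * M i.1 j = 0 := fun j => by
    have := congrFun hg0 j
    simpa [Finset.sum_apply, Pi.smul_apply, smul_eq_mul] using this
  -- `α` takes both signs
  have hne : (Finset.univ : Finset s).Nonempty := ⟨i₁, Finset.mem_univ _⟩
  obtain ⟨ip, -, hip⟩ := Finset.exists_max_image Finset.univ g hne
  obtain ⟨im, -, him⟩ := Finset.exists_max_image Finset.univ (fun i => -g i) hne
  have hrow_ne : ∀ i : s, ∃ j, M i.1 j ≠ 0 := fun i => by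
    have h := (hs i.1).mp i.2
    by_contra hall
    apply h
    funext j
    by_contra hj
    exact hall ⟨j, hj⟩
  have hpos : 0 < g ip := by
    by_contra hle
    have hle : g ip ≤ 0 := not_lt.mp hle
    -- all `g i ≤ 0`: each term of the relation vanishes, so `g = 0` on nonzero rows
    have hall : ∀ i : s, g i ≤ 0 := fun i => (hip i (Finset.mem_univ _)).trans hle
    have hz : ∀ i : s, g i = 0 := by
      intro i
      obtain ⟨j, hj⟩ := hrow_ne i
      have hterm : ∀ k ∈ (Finset.univ : Finset s), g k * M k.1 j ≤ 0 := fun k _ =>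
        mul_nonpos_of_nonpos_of_nonneg (hall k) (hM _ _)
      have := (Finset.sum_eq_zero_iff_of_nonpos hterm).mp (hrel j) i (Finset.mem_univ _)
      rcases mul_eq_zero.mp this with h | h
      · exact h
      · exact absurd h hj
    exact hi₁ (hz i₁)
  have hneg : g im < 0 := by
    by_contra hle
    have hle : 0 ≤ g im := not_lt.mp hle
    have hall : ∀ i : s, 0 ≤ g i := fun i => by
      have := him i (Finset.mem_univ _); linarith
    have hz : ∀ i : s, g i = 0 := by
      intro i
      obtain ⟨j, hj⟩ := hrow_ne i
      have hterm : ∀ k ∈ (Finset.univ : Finset s), 0 ≤ g k * M k.1 j := fun k _ =>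
        mul_nonneg (hall k) (hM _ _)
      have := (Finset.sum_eq_zero_iff_of_nonneg hterm).mp (hrel j) i (Finset.mem_univ _)
      rcases mul_eq_zero.mp this with h | h
      · exact h
      · exact absurd h hj
    exact hi₁ (hz i₁)
  -- extend `α` by zero to all rows
  let α : Fin n → ℝ := fun i => if h : i ∈ s then g ⟨i, h⟩ else 0
  have hαs : ∀ i : s, α i.1 = g i := fun i => by simp [α, i.2]
  have hαsum : ∀ f : Fin n → ℝ, ∑ i, α i * f i = ∑ i : s, g i * f i.1 := by
    intro f
    have h1 : ∑ i, α i * f i = ∑ i ∈ s, α i * f i := by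
      refine (Finset.sum_subset (Finset.subset_univ s) fun i _ hi => ?_).symm
      simp [α, hi]
    rw [h1, ← Finset.sum_coe_sort]
    exact Finset.sum_congr rfl fun i _ => by rw [hαs]
  have hαrel : ∀ j, ∑ i, α i * M i j = 0 := fun j => by rw [hαsum]; exact hrel j
  -- the objective slope
  set Λ : ℝ := ∑ i, α i * w i with hΛ
  -- choose the end of `Δ_α` by the sign of `Λ`
  by_cases hΛ0 : 0 ≤ Λ
  · -- `ε = −1/min α = 1/|g im| > 0`
    set ε : ℝ := -1 / g im with hε
    have hεpos : 0 < ε := by rw [hε]; exact div_pos_of_neg_of_neg (by norm_num) hneg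
    refine ⟨fun i => 1 + ε * α i, fun i => ?_, fun j => ?_, ?_, ⟨im.1, im.2, ?_⟩⟩
    · show 0 ≤ 1 + ε * α i
      by_cases hi : i ∈ s
      · have h1 : α i = g ⟨i, hi⟩ := hαs ⟨i, hi⟩
        have h2 : -g ⟨i, hi⟩ ≤ -g im := him ⟨i, hi⟩ (Finset.mem_univ _)
        rw [h1, hε]
        have : -1 / g im * g ⟨i, hi⟩ = -(g ⟨i, hi⟩ / g im) := by ring
        rw [this]
        have h3 : g ⟨i, hi⟩ / g im ≤ 1 := by
          rw [div_le_one_of_neg hneg]; linarith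
        linarith
      · simp [α, hi]
    · simp_rw [add_mul, one_mul, Finset.sum_add_distrib, mul_assoc, ← Finset.mul_sum, hαrel j]
      ring
    · simp_rw [add_mul, one_mul, Finset.sum_add_distrib, mul_assoc, ← Finset.mul_sum, ← hΛ]
      nlinarith
    · show 1 + ε * α im.1 = 0
      have h0 : g im ≠ 0 := hneg.ne
      rw [hαs im, hε]
      field_simp
      ring
  · -- `ε = −1/max α < 0`
    have hΛ0 : Λ < 0 := not_le.mp hΛ0
    set ε : ℝ := -1 / g ip with hε
    have hεneg : ε < 0 := by rw [hε]; exact div_neg_of_neg_of_pos (by norm_num) hpos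
    refine ⟨fun i => 1 + ε * α i, fun i => ?_, fun j => ?_, ?_, ⟨ip.1, ip.2, ?_⟩⟩
    · show 0 ≤ 1 + ε * α i
      by_cases hi : i ∈ s
      · have h1 : α i = g ⟨i, hi⟩ := hαs ⟨i, hi⟩
        have h2 : g ⟨i, hi⟩ ≤ g ip := hip ⟨i, hi⟩ (Finset.mem_univ _)
        rw [h1, hε]
        have : -1 / g ip * g ⟨i, hi⟩ = -(g ⟨i, hi⟩ / g ip) := by ring
        rw [this]
        have h3 : g ⟨i, hi⟩ / g ip ≤ 1 := by rw [div_le_one hpos]; exact h2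
        linarith
      · simp [α, hi]
    · simp_rw [add_mul, one_mul, Finset.sum_add_distrib, mul_assoc, ← Finset.mul_sum, hαrel j]
      ring
    · simp_rw [add_mul, one_mul, Finset.sum_add_distrib, mul_assoc, ← Finset.mul_sum, ← hΛ]
      nlinarith
    · show 1 + ε * α ip.1 = 0
      have h0 : g ip ≠ 0 := hpos.ne'
      rw [hαs ip, hε]
      field_simp
      ring

/-- **Riazanov–Vyalyi Theorem 4.3** (p08, verbatim: "Let `M ∈ ℝ^{n×m}` be a stochastic matrix,
`rank M = r`. Then `B₄(M) ≤ r`", `B₄(M) = Σ_i max_j M(i,j)`, "stochastic" = nonnegative with every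
column summing to `1`, p05), with `max_j` as an arbitrary column selection `c` (the tree's form of `B₄`,
cf. `LeeWeiDeWolf2017_thm24_real`): `Σ_i M(i, c(i)) ≤ rank M`. Printed proof: iterate the row
elimination transformation at the end of `Δ_α` where `B₄` does not decrease, until the nonzero rows are
linearly independent (at most `rank` of them), each contributing `max_j M(i,j) ≤ 1`.
[cite: RiazanovVyalyiy2017, Thm. 4.3 (p08)] -/
theorem RiazanovVyalyiy2017_thm43 (M : Matrix (Fin n) (Fin m) ℝ) (hM : ∀ i j, 0 ≤ M i j)
    (hcol : ∀ j, ∑ i, M i j = 1) (c : Fin n → Fin m) : ∑ i, M i (c i) ≤ M.rank := by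
  classical
  -- induction on the number of nonzero rows, for all column-stochastic nonnegative matrices
  suffices key : ∀ (k : ℕ) (A : Matrix (Fin n) (Fin m) ℝ), (∀ i j, 0 ≤ A i j) → (∀ j, ∑ i, A i j = 1) →
      (Finset.univ.filter fun i => A i ≠ 0).card ≤ k → ∑ i, A i (c i) ≤ A.rank from
    key _ M hM hcol le_rfl
  intro k
  induction k with
  | zero =>
    intro A hA _ hcard
    have hzero : ∀ i, A i = 0 := fun i => by
      by_contra h
      have : i ∈ Finset.univ.filter (fun i => A i ≠ 0) := by simp [h]
      rw [Nat.le_zero, Finset.card_eq_zero] at hcard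
      rw [hcard] at this
      simp at this
    have : ∑ i, A i (c i) = 0 := Finset.sum_eq_zero fun i _ => by rw [hzero i]; rfl
    rw [this]
    exact Nat.cast_nonneg _
  | succ k ih =>
    intro A hA hAcol hcard
    set s : Finset (Fin n) := Finset.univ.filter fun i => A i ≠ 0 with hsdef
    have hs : ∀ i, i ∈ s ↔ A i ≠ 0 := fun i => by simp [hsdef]
    -- entries are at most the column sums
    have hle1 : ∀ i j, A i j ≤ 1 := fun i j => by
      rw [← hAcol j]
      exact Finset.single_le_sum (fun k _ => hA k j) (Finset.mem_univ i)
    by_cases hli : LinearIndependent ℝ (fun i : s => A i.1)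
    · -- terminal case: at most `rank` nonzero rows, each contributing `≤ 1`
      have hcard_le := card_le_rank_of_linearIndependent_rows A hli
      calc ∑ i, A i (c i) = ∑ i ∈ s, A i (c i) := by
            refine (Finset.sum_subset (Finset.subset_univ s) fun i _ hi => ?_).symm
            have : A i = 0 := by simpa [hs] using hi
            rw [this]; rfl
        _ ≤ ∑ _i ∈ s, (1 : ℝ) := Finset.sum_le_sum fun i _ => hle1 i (c i)
        _ = s.card := by simp
        _ ≤ A.rank := by exact_mod_cast hcard_le
    · -- one row elimination step, then the induction hypothesis
      obtain ⟨d, hd0, hdcol, hdobj, i₀, hi₀s, hdi₀⟩ :=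
        exists_rowElimination A hA hs hli (fun i => A i (c i))
      set A' : Matrix (Fin n) (Fin m) ℝ := Matrix.of fun i j => d i * A i j with hA'
      have hA'nn : ∀ i j, 0 ≤ A' i j := fun i j => mul_nonneg (hd0 i) (hA i j)
      have hA'col : ∀ j, ∑ i, A' i j = 1 := fun j => by
        simp only [hA', Matrix.of_apply]; rw [hdcol j, hAcol j]
      have hA'card : (Finset.univ.filter fun i => A' i ≠ 0).card ≤ k := by
        have hsub : (Finset.univ.filter fun i => A' i ≠ 0) ⊂ s := by
          rw [Finset.ssubset_iff_of_subset]
          · refine ⟨i₀, hi₀s, ?_⟩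
            simp only [Finset.mem_filter, Finset.mem_univ, true_and, not_not]
            funext j
            simp [hA', hdi₀]
          · intro i hi
            rw [Finset.mem_filter] at hi
            rw [hs]
            intro h0
            apply hi.2
            funext j
            simp [hA', h0]
        have := Finset.card_lt_card hsub
        omega
      have hrank : A'.rank ≤ A.rank := by
        have hmul : A' = Matrix.diagonal d * A := by
          ext i j; simp [hA', Matrix.diagonal_mul]
        rw [hmul]; exact Matrix.rank_mul_le_right _ _
      calc ∑ i, A i (c i) ≤ ∑ i, d i * A i (c i) := hdobj
        _ = ∑ i, A' i (c i) := by simp [hA']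
        _ ≤ A'.rank := ih A' hA'nn hA'col hA'card
        _ ≤ A.rank := by exact_mod_cast hrank

/-- **`B₄ ≤ min(rank, rank_psd^ℝ)`**: Riazanov–Vyalyi Theorem 4.3 next to Lee–Wei–de Wolf Theorem 24
(the tree's `LeeWeiDeWolf2017_thm24_real`) — "these functionals cannot give exponential bounds on the
PSD-rank" relative to the rank (p03). [cite: RiazanovVyalyiy2017, Thm. 4.3 (p08) and §1 (p03)] -/
theorem RiazanovVyalyiy2017_thm43_le_min (M : Matrix (Fin n) (Fin m) ℝ) (hM : ∀ i j, 0 ≤ M i j)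
    (hcol : ∀ j, ∑ i, M i j = 1) {r : ℕ} (hr : HasPsdFactorization (fun i j => M i j) r)
    (c : Fin n → Fin m) : ∑ i, M i (c i) ≤ min (M.rank : ℝ) r :=
  le_min (RiazanovVyalyiy2017_thm43 M hM hcol c) (LeeWeiDeWolf2017_thm24_real hr hcol c)

/-! ### Theorem 4.1: the mutual information is at most `log rank` (appended) -/

/-- Row and column marginals of a joint-distribution matrix: `p_i = Σ_j m_ij`.
[cite: RiazanovVyalyiy2017, §4.2 (p06)] -/
def rowMarginal (M : Matrix (Fin n) (Fin m) ℝ) (i : Fin n) : ℝ := ∑ j, M i j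

/-- `q_j = Σ_i m_ij`. [cite: RiazanovVyalyiy2017, §4.2 (p06)] -/
def colMarginal (M : Matrix (Fin n) (Fin m) ℝ) (j : Fin m) : ℝ := ∑ i, M i j

/-- The contribution of row `i` to the mutual information, `Σ_j m_ij log(m_ij/(p_i q_j))`.
[cite: RiazanovVyalyiy2017, §4.2 (p06)] -/
def rowMutualInfo (M : Matrix (Fin n) (Fin m) ℝ) (i : Fin n) : ℝ :=
  ∑ j, M i j * Real.log (M i j / (rowMarginal M i * colMarginal M j))

/-- **The mutual information of a joint-distribution matrix** (p06, verbatim: "`I(X : Y) = … =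
Σ_i Σ_j m_ij log₂(m_ij/(p_i q_j))`, where we set `0 log(0/q) = 0` … We also denote `I(M) = I(X:Y)`"),
here with the natural logarithm (the printed `log₂` version is `I(M)/log 2`; Theorem 4.1's `2^{I} ≤ rank`
becomes `exp(I(M)) ≤ rank`). Mathlib's `Real.log 0 = 0` realises the convention `0 log(0/q) = 0`.
[cite: RiazanovVyalyiy2017, §4.2 (p06)] -/
def mutualInfo (M : Matrix (Fin n) (Fin m) ℝ) : ℝ := ∑ i, rowMutualInfo M i

/-- Entries of a nonnegative matrix are bounded by the marginals. [folklore] -/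
private theorem le_rowMarginal {M : Matrix (Fin n) (Fin m) ℝ} (hM : ∀ i j, 0 ≤ M i j) (i : Fin n) (j : Fin m) :
    M i j ≤ rowMarginal M i :=
  Finset.single_le_sum (fun k _ => hM i k) (Finset.mem_univ j)

/-- Entries of a nonnegative matrix are bounded by the marginals. [folklore] -/
private theorem le_colMarginal {M : Matrix (Fin n) (Fin m) ℝ} (hM : ∀ i j, 0 ≤ M i j) (i : Fin n) (j : Fin m) :
    M i j ≤ colMarginal M j :=
  Finset.single_le_sum (fun k _ => hM k j) (Finset.mem_univ i)

/-- **`I(M) ≤ H(X)`** ("`I(X̃ : Ỹ) = H(X̃) − H(X̃ | Ỹ)` and the non-negativity of the conditional entropy"):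
termwise, `m_ij log(m_ij/(p_i q_j)) + m_ij log p_i = m_ij log(m_ij/q_j) ≤ 0` as `m_ij ≤ q_j`.
[cite: RiazanovVyalyiy2017, Thm. 4.1 proof (p07)] -/
theorem mutualInfo_le_entropy (M : Matrix (Fin n) (Fin m) ℝ) (hM : ∀ i j, 0 ≤ M i j) :
    mutualInfo M ≤ ∑ i, Real.negMulLog (rowMarginal M i) := by
  unfold mutualInfo rowMutualInfo
  refine Finset.sum_le_sum fun i _ => ?_
  -- `Σ_j m_ij log(m_ij/(p_i q_j)) ≤ -p_i log p_i = Σ_j (-m_ij log p_i)`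
  have hp : Real.negMulLog (rowMarginal M i) = ∑ j, -(M i j * Real.log (rowMarginal M i)) := by
    rw [Real.negMulLog, rowMarginal, Finset.sum_neg_distrib, ← Finset.sum_mul, neg_mul]
  rw [hp]
  refine Finset.sum_le_sum fun j _ => ?_
  rcases (hM i j).eq_or_lt with h0 | hpos
  · rw [← h0]; simp
  · have hpi : 0 < rowMarginal M i := lt_of_lt_of_le hpos (le_rowMarginal hM i j)
    have hqj : 0 < colMarginal M j := lt_of_lt_of_le hpos (le_colMarginal hM i j)
    have hlog : Real.log (M i j / (rowMarginal M i * colMarginal M j)) =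
        Real.log (M i j / colMarginal M j) - Real.log (rowMarginal M i) := by
      rw [Real.log_div hpos.ne' (mul_pos hpi hqj).ne', Real.log_mul hpi.ne' hqj.ne',
        Real.log_div hpos.ne' hqj.ne']
      ring
    rw [hlog, mul_sub]
    have hle : Real.log (M i j / colMarginal M j) ≤ 0 :=
      Real.log_nonpos (div_nonneg hpos.le hqj.le) ((div_le_one hqj).mpr (le_colMarginal hM i j))
    nlinarith

/-- **`H(X) ≤ log |supp X|`** (Jensen for the concave `−x log x` over the support).
[cite: RiazanovVyalyiy2017, Thm. 4.1 proof (p07, "H(X̃) ≤ log |supp(X̃)|")] -/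
theorem sum_negMulLog_le_log_card {ι : Type*} [Fintype ι] {p : ι → ℝ} (hp : ∀ i, 0 ≤ p i)
    (hsum : ∑ i, p i = 1) {S : Finset ι} (hS : ∀ i, i ∉ S → p i = 0) :
    ∑ i, Real.negMulLog (p i) ≤ Real.log S.card := by
  classical
  have hsumS : ∑ i ∈ S, p i = 1 := by
    rw [← hsum]
    exact Finset.sum_subset (Finset.subset_univ S) fun i _ hi => by rw [hS i hi]
  have hSne : S.Nonempty := by
    by_contra h
    rw [Finset.not_nonempty_iff_eq_empty] at h
    rw [h, Finset.sum_empty] at hsumS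
    exact zero_ne_one hsumS
  have hcard : (0 : ℝ) < S.card := by exact_mod_cast hSne.card_pos
  have hoff : ∑ i, Real.negMulLog (p i) = ∑ i ∈ S, Real.negMulLog (p i) := by
    refine (Finset.sum_subset (Finset.subset_univ S) fun i _ hi => ?_).symm
    rw [hS i hi, Real.negMulLog_zero]
  rw [hoff]
  -- Jensen with uniform weights on `S`
  have hJ := Real.concaveOn_negMulLog.le_map_sum (t := S) (w := fun _ => (S.card : ℝ)⁻¹) (p := p)
    (fun _ _ => by positivity) (by rw [Finset.sum_const, nsmul_eq_mul, mul_inv_cancel₀ hcard.ne'])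
    (fun i _ => Set.mem_Ici.2 (hp i))
  simp only [smul_eq_mul, ← Finset.mul_sum, hsumS, mul_one] at hJ
  rw [Real.negMulLog, Real.log_inv, mul_neg, neg_mul, neg_neg] at hJ
  have h := mul_le_mul_of_nonneg_left hJ hcard.le
  rwa [← mul_assoc, mul_inv_cancel₀ hcard.ne', one_mul, ← mul_assoc, mul_inv_cancel₀ hcard.ne',
    one_mul] at h

/-- Row scaling that preserves the column sums multiplies the row terms of `I`:
`I(M^ε)`'s row `i` is `(1 + εα_i)` times `I(M)`'s ("`I(M^ε) − I(M) = ε·Λ`": the ratios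
`m_ij/(p_i q_j)` do not change). [cite: RiazanovVyalyiy2017, Thm. 4.1 proof (p06–p07)] -/
theorem rowMutualInfo_rowScale (M : Matrix (Fin n) (Fin m) ℝ) (d : Fin n → ℝ) (hd : ∀ i, 0 ≤ d i)
    (hdcol : ∀ j, ∑ i, d i * M i j = ∑ i, M i j) (i : Fin n) :
    rowMutualInfo (Matrix.of fun i j => d i * M i j) i = d i * rowMutualInfo M i := by
  have hq : ∀ j, colMarginal (Matrix.of fun i j => d i * M i j) j = colMarginal M j := fun j => by
    simp only [colMarginal, Matrix.of_apply]; exact hdcol j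
  have hp : rowMarginal (Matrix.of fun i j => d i * M i j) i = d i * rowMarginal M i := by
    simp only [rowMarginal, Matrix.of_apply, Finset.mul_sum]
  unfold rowMutualInfo
  simp only [hq, hp, Matrix.of_apply, Finset.mul_sum]
  refine Finset.sum_congr rfl fun j _ => ?_
  rcases (hd i).eq_or_lt with h0 | hpos
  · rw [← h0]; simp
  · rw [show d i * rowMarginal M i * colMarginal M j = d i * (rowMarginal M i * colMarginal M j) by ring,
      mul_div_mul_left _ _ hpos.ne', mul_assoc]

/-- A nonzero matrix has positive rank. [folklore] -/
private theorem rank_pos_of_ne_zero {A : Matrix (Fin n) (Fin m) ℝ} (hA : A ≠ 0) : 0 < A.rank := by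
  rw [pos_iff_ne_zero]
  intro h0
  apply hA
  have hbot : LinearMap.range A.mulVecLin = ⊥ := Submodule.finrank_eq_zero.mp h0
  have hlin : A.mulVecLin = 0 := LinearMap.range_eq_bot.mp hbot
  ext i j
  have h := congrFun (LinearMap.congr_fun hlin (Pi.single j 1)) i
  rw [Matrix.mulVecLin_apply, Matrix.mulVec_single_one, LinearMap.zero_apply] at h
  exact h

/-- A matrix of total mass `1` is nonzero, hence has positive rank. [folklore] -/
private theorem rank_pos_of_sum_eq_one {A : Matrix (Fin n) (Fin m) ℝ} (hsum : ∑ i, ∑ j, A i j = 1) :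
    0 < A.rank := by
  refine rank_pos_of_ne_zero fun h0 => ?_
  have : ∑ i, ∑ j, A i j = 0 := by rw [h0]; simp
  rw [this] at hsum
  exact zero_ne_one hsum

/-- **Riazanov–Vyalyi Theorem 4.1** (p06, verbatim: "Let `M ∈ ℝ^{n×m}` be the matrix of a joint
distribution of `X` and `Y`. Then `B₂(M) = 2^{I(X:Y)} ≤ rank M`"), as `I(M) ≤ log(rank M)` (natural
logarithm). Printed proof: row elimination with `I(M^ε) − I(M) = εΛ` down to at most `rank` nonzero rows,
then `I ≤ H(X̃) ≤ log|supp X̃| ≤ log r`. [cite: RiazanovVyalyiy2017, Thm. 4.1 (p06–p07)] -/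
theorem RiazanovVyalyiy2017_thm41 (M : Matrix (Fin n) (Fin m) ℝ) (hM : ∀ i j, 0 ≤ M i j)
    (hsum : ∑ i, ∑ j, M i j = 1) : mutualInfo M ≤ Real.log M.rank := by
  classical
  suffices key : ∀ (k : ℕ) (A : Matrix (Fin n) (Fin m) ℝ), (∀ i j, 0 ≤ A i j) → (∑ i, ∑ j, A i j = 1) →
      (Finset.univ.filter fun i => A i ≠ 0).card ≤ k → mutualInfo A ≤ Real.log A.rank from
    key _ M hM hsum le_rfl
  intro k
  induction k with
  | zero =>
    intro A hA hAsum hcard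
    exfalso
    have hzero : ∀ i, A i = 0 := fun i => by
      by_contra h
      have : i ∈ Finset.univ.filter (fun i => A i ≠ 0) := by simp [h]
      rw [Nat.le_zero, Finset.card_eq_zero] at hcard
      rw [hcard] at this
      simp at this
    have : ∑ i, ∑ j, A i j = 0 :=
      Finset.sum_eq_zero fun i _ => Finset.sum_eq_zero fun j _ => by rw [hzero i]; rfl
    rw [this] at hAsum
    exact zero_ne_one hAsum
  | succ k ih =>
    intro A hA hAsum hcard
    set s : Finset (Fin n) := Finset.univ.filter fun i => A i ≠ 0 with hsdef
    have hs : ∀ i, i ∈ s ↔ A i ≠ 0 := fun i => by simp [hsdef]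
    by_cases hli : LinearIndependent ℝ (fun i : s => A i.1)
    · -- terminal case: `I ≤ H(X) ≤ log |s| ≤ log rank`
      have hcard_le := card_le_rank_of_linearIndependent_rows A hli
      have hoff : ∀ i, i ∉ s → rowMarginal A i = 0 := fun i hi => by
        have : A i = 0 := by simpa [hs] using hi
        simp [rowMarginal, this]
      have hp0 : ∀ i, 0 ≤ rowMarginal A i := fun i => Finset.sum_nonneg fun j _ => hA i j
      have hp1 : ∑ i, rowMarginal A i = 1 := hAsum
      have hsne : s.Nonempty := by
        by_contra h
        rw [Finset.not_nonempty_iff_eq_empty] at h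
        have : ∑ i, rowMarginal A i = 0 := Finset.sum_eq_zero fun i _ => hoff i (by simp [h])
        rw [hp1] at this
        exact one_ne_zero this
      calc mutualInfo A ≤ ∑ i, Real.negMulLog (rowMarginal A i) := mutualInfo_le_entropy A hA
        _ ≤ Real.log s.card := sum_negMulLog_le_log_card hp0 hp1 hoff
        _ ≤ Real.log A.rank :=
            Real.log_le_log (by exact_mod_cast hsne.card_pos) (by exact_mod_cast hcard_le)
    · -- one row elimination step (objective `w_i = I`'s row terms), then induction
      obtain ⟨d, hd0, hdcol, hdobj, i₀, hi₀s, hdi₀⟩ :=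
        exists_rowElimination A hA hs hli (rowMutualInfo A)
      set A' : Matrix (Fin n) (Fin m) ℝ := Matrix.of fun i j => d i * A i j with hA'
      have hA'nn : ∀ i j, 0 ≤ A' i j := fun i j => mul_nonneg (hd0 i) (hA i j)
      have hA'sum : ∑ i, ∑ j, A' i j = 1 := by
        rw [Finset.sum_comm]
        simp only [hA', Matrix.of_apply]
        simp_rw [hdcol]
        rw [Finset.sum_comm]
        exact hAsum
      have hA'card : (Finset.univ.filter fun i => A' i ≠ 0).card ≤ k := by
        have hsub : (Finset.univ.filter fun i => A' i ≠ 0) ⊂ s := by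
          rw [Finset.ssubset_iff_of_subset]
          · refine ⟨i₀, hi₀s, ?_⟩
            simp only [Finset.mem_filter, Finset.mem_univ, true_and, not_not]
            funext j
            simp [hA', hdi₀]
          · intro i hi
            rw [Finset.mem_filter] at hi
            rw [hs]
            intro h0
            apply hi.2
            funext j
            simp [hA', h0]
        have := Finset.card_lt_card hsub
        omega
      have hrank : A'.rank ≤ A.rank := by
        have hmul : A' = Matrix.diagonal d * A := by
          ext i j; simp [hA', Matrix.diagonal_mul]
        rw [hmul]; exact Matrix.rank_mul_le_right _ _
      have hA'pos : 0 < A'.rank := rank_pos_of_sum_eq_one hA'sum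
      have hI : mutualInfo A' = ∑ i, d i * rowMutualInfo A i := by
        unfold mutualInfo
        exact Finset.sum_congr rfl fun i _ => rowMutualInfo_rowScale A d hd0 hdcol i
      calc mutualInfo A = ∑ i, rowMutualInfo A i := rfl
        _ ≤ ∑ i, d i * rowMutualInfo A i := hdobj
        _ = mutualInfo A' := hI.symm
        _ ≤ Real.log A'.rank := ih A' hA'nn hA'sum hA'card
        _ ≤ Real.log A.rank :=
            Real.log_le_log (by exact_mod_cast hA'pos) (by exact_mod_cast hrank)

/-- **Theorem 4.1 in the printed base-2 form**: `2^{I₂(M)} ≤ rank M` with `I₂ = I/log 2`, i.e.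
`exp(I(M)) ≤ rank M`. [cite: RiazanovVyalyiy2017, Thm. 4.1 (p06)] -/
theorem RiazanovVyalyiy2017_thm41_exp (M : Matrix (Fin n) (Fin m) ℝ) (hM : ∀ i j, 0 ≤ M i j)
    (hsum : ∑ i, ∑ j, M i j = 1) : Real.exp (mutualInfo M) ≤ M.rank := by
  have h := RiazanovVyalyiy2017_thm41 M hM hsum
  have hpos : 0 < (M.rank : ℝ) := by exact_mod_cast rank_pos_of_sum_eq_one hsum
  calc Real.exp (mutualInfo M) ≤ Real.exp (Real.log M.rank) := Real.exp_le_exp.mpr h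
    _ = M.rank := Real.exp_log hpos

/-! ### Theorem 4.2 (`B₃`), first part: Lemma 4.1 and the statistical-distance functional
(Lemmas 4.3–4.4) -/

/-- The `ℓ¹` distance between the columns `s, t` of `M` (twice their statistical distance when `M` is
column-stochastic). [cite: RiazanovVyalyiy2017, Lemma 4.1 (p07, "|p − q| is l₁-norm")] -/
def colL1Dist (M : Matrix (Fin n) (Fin m) ℝ) (s t : Fin m) : ℝ := ∑ k, |M k s - M k t|

/-- `(√a − √b)² ≤ |a − b|` for `a, b ≥ 0`. [folklore] -/
private theorem sq_sqrt_sub_sqrt_le {a b : ℝ} (ha : 0 ≤ a) (hb : 0 ≤ b) :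
    (Real.sqrt a - Real.sqrt b) ^ 2 ≤ |a - b| := by
  have hfac : a - b = (Real.sqrt a - Real.sqrt b) * (Real.sqrt a + Real.sqrt b) := by
    have h1 := Real.mul_self_sqrt ha
    have h2 := Real.mul_self_sqrt hb
    nlinarith
  rw [hfac, abs_mul, sq, ← abs_mul_abs_self (Real.sqrt a - Real.sqrt b)]
  rw [abs_mul_abs_self]
  have h3 : |Real.sqrt a - Real.sqrt b| ≤ |Real.sqrt a + Real.sqrt b| := by
    rw [abs_of_nonneg (add_nonneg (Real.sqrt_nonneg a) (Real.sqrt_nonneg b))]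
    exact abs_sub_le_iff.mpr ⟨by linarith [Real.sqrt_nonneg b], by linarith [Real.sqrt_nonneg a]⟩
  calc (Real.sqrt a - Real.sqrt b) * (Real.sqrt a - Real.sqrt b)
      ≤ |Real.sqrt a - Real.sqrt b| * |Real.sqrt a - Real.sqrt b| := by
        rw [← abs_mul_abs_self]
    _ ≤ |Real.sqrt a - Real.sqrt b| * |Real.sqrt a + Real.sqrt b| :=
        mul_le_mul_of_nonneg_left h3 (abs_nonneg _)

/-- **Riazanov–Vyalyi Lemma 4.1** (p07, verbatim: "For distributions `p, q` it holds `F(p,q) ≥ 1 − |p − q|/2`,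
where `|p−q|` is `l₁`-norm of the vector `(p−q)`"; proof: `1 − Σ√(p_kq_k) = ½Σ|√p_k − √q_k|² ≤ ½Σ|p_k − q_k|`),
for two columns of a column-stochastic matrix. [cite: RiazanovVyalyiy2017, Lemma 4.1 (p07)] -/
theorem RiazanovVyalyiy2017_lemma41 (M : Matrix (Fin n) (Fin m) ℝ) (hM : ∀ i j, 0 ≤ M i j)
    (hcol : ∀ j, ∑ i, M i j = 1) (s t : Fin m) :
    1 - colL1Dist M s t / 2 ≤ classicalFidelity (fun k => M k s) (fun k => M k t) := by
  unfold classicalFidelity colL1Dist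
  -- `1 − Σ √p√q = ½ Σ (√p − √q)²`
  have hkey : 1 - ∑ k, Real.sqrt (M k s) * Real.sqrt (M k t) =
      (1 / 2) * ∑ k, (Real.sqrt (M k s) - Real.sqrt (M k t)) ^ 2 := by
    have h1 : ∑ k, (Real.sqrt (M k s) - Real.sqrt (M k t)) ^ 2 =
        ∑ k, (M k s + M k t - 2 * (Real.sqrt (M k s) * Real.sqrt (M k t))) := by
      refine Finset.sum_congr rfl fun k _ => ?_
      have ha := Real.sq_sqrt (hM k s)
      have hb := Real.sq_sqrt (hM k t)
      nlinarith
    rw [h1, Finset.sum_sub_distrib, Finset.sum_add_distrib, hcol s, hcol t, ← Finset.mul_sum]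
    ring
  have hle : ∑ k, (Real.sqrt (M k s) - Real.sqrt (M k t)) ^ 2 ≤ ∑ k, |M k s - M k t| :=
    Finset.sum_le_sum fun k _ => sq_sqrt_sub_sqrt_le (hM k s) (hM k t)
  linarith

/-- `|a − b| = a + b − 2 min(a,b)`. [folklore] -/
private theorem abs_sub_eq_add_sub_two_mul_min (a b : ℝ) : |a - b| = a + b - 2 * min a b := by
  rcases le_total a b with h | h
  · rw [abs_of_nonpos (by linarith), min_eq_left h]; ring
  · rw [abs_of_nonneg (by linarith), min_eq_right h]; ring

/-- `ab ≤ min(a,b)` on `[0,1]²`. [folklore] -/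
private theorem mul_le_min_of_unit {a b : ℝ} (ha0 : 0 ≤ a) (ha1 : a ≤ 1) (hb0 : 0 ≤ b) (hb1 : b ≤ 1) :
    a * b ≤ min a b := by
  rcases le_total a b with h | h
  · rw [min_eq_left h]; nlinarith
  · rw [min_eq_right h]; nlinarith

/-- The row terms of the statistical-distance functional: `w_k = Σ_{s,t} |m_ks − m_kt|`
(`Z(M) = ½ Σ_k w_k`, `S(M) = Z(M)/m²`). [cite: RiazanovVyalyiy2017, Lemma 4.3 proof (p07) and Lemma 4.4 (p08, Z(M))] -/
def rowL1Spread (M : Matrix (Fin n) (Fin m) ℝ) (k : Fin n) : ℝ := ∑ s, ∑ t, |M k s - M k t|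

/-- `Σ_{s,t} |M_s − M_t|₁ = Σ_k w_k`. [cite: RiazanovVyalyiy2017, Lemma 4.3 proof (p07)] -/
theorem sum_colL1Dist_eq (M : Matrix (Fin n) (Fin m) ℝ) :
    ∑ s, ∑ t, colL1Dist M s t = ∑ k, rowL1Spread M k := by
  unfold colL1Dist rowL1Spread
  calc ∑ s, ∑ t, ∑ k, |M k s - M k t| = ∑ s, ∑ k, ∑ t, |M k s - M k t| :=
        Finset.sum_congr rfl fun s _ => Finset.sum_comm
    _ = ∑ k, ∑ s, ∑ t, |M k s - M k t| := Finset.sum_comm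

/-- Row scaling multiplies the row terms: `w_k(M^ε) = (1 + εα_k) w_k(M)` ("`S(M^ε) − S(M) = ε·Λ`").
[cite: RiazanovVyalyiy2017, Lemma 4.3 proof (p07)] -/
theorem rowL1Spread_rowScale (M : Matrix (Fin n) (Fin m) ℝ) (d : Fin n → ℝ) (hd : ∀ i, 0 ≤ d i) (k : Fin n) :
    rowL1Spread (Matrix.of fun i j => d i * M i j) k = d k * rowL1Spread M k := by
  unfold rowL1Spread
  simp only [Matrix.of_apply, Finset.mul_sum]
  refine Finset.sum_congr rfl fun s _ => Finset.sum_congr rfl fun t _ => ?_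
  rw [← mul_sub, abs_mul, abs_of_nonneg (hd k)]

/-- **Lemma 4.4, by a shorter road** (printed: "Let `M ∈ ℝ^{r×m}` be a stochastic matrix. Then
`S(M) ≤ 1 − 1/r`", proved there by sorting the rows and maximising `Z`; here: `½|a−b| = ½(a+b) − min(a,b)`,
`min(a,b) ≥ ab` on `[0,1]`, so `Σ_{s,t} Σ_k min(m_ks, m_kt) ≥ Σ_k R_k² ≥ m²/r` by Cauchy–Schwarz over the
`r` nonzero rows, `R_k` the row sums): if the nonzero rows of a column-stochastic `A` lie in `s ≠ ∅`, then
`Σ_k w_k(A) ≤ 2m²(1 − 1/|s|)`. [cite: RiazanovVyalyiy2017, Lemma 4.4 (p08)] -/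
theorem sum_rowL1Spread_le_of_support (A : Matrix (Fin n) (Fin m) ℝ) (hA : ∀ i j, 0 ≤ A i j)
    (hcol : ∀ j, ∑ i, A i j = 1) {s : Finset (Fin n)} (hs : ∀ i, i ∉ s → A i = 0) (hsne : s.Nonempty) :
    ∑ k, rowL1Spread A k ≤ 2 * (m : ℝ) ^ 2 * (1 - 1 / s.card) := by
  classical
  have hle1 : ∀ i j, A i j ≤ 1 := fun i j => by
    rw [← hcol j]; exact Finset.single_le_sum (fun k _ => hA k j) (Finset.mem_univ i)
  -- row sums
  set R : Fin n → ℝ := fun k => ∑ s, A k s with hR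
  have hRsum : ∑ k, R k = m := by
    simp only [hR]
    rw [Finset.sum_comm]
    simp [hcol]
  have hRoff : ∀ k, k ∉ s → R k = 0 := fun k hk => by simp [hR, hs k hk]
  -- `Σ_k w_k = 2m² − 2 Σ_k Σ_{s,t} min`
  have hw : ∑ k, rowL1Spread A k = 2 * (m : ℝ) ^ 2 - 2 * ∑ k, ∑ s, ∑ t, min (A k s) (A k t) := by
    unfold rowL1Spread
    simp_rw [abs_sub_eq_add_sub_two_mul_min]
    simp only [Finset.sum_sub_distrib, Finset.sum_add_distrib, ← Finset.mul_sum]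
    have h1 : ∑ k, ∑ s : Fin m, ∑ _t : Fin m, A k s = (m : ℝ) ^ 2 := by
      simp only [Finset.sum_const, Finset.card_univ, Fintype.card_fin, nsmul_eq_mul]
      rw [Finset.sum_comm]
      simp_rw [← Finset.mul_sum, hcol]
      simp [sq]
    have h2 : ∑ k, ∑ _s : Fin m, ∑ t : Fin m, A k t = (m : ℝ) ^ 2 := by
      simp only [Finset.sum_const, Finset.card_univ, Fintype.card_fin, nsmul_eq_mul]
      rw [← Finset.mul_sum, Finset.sum_comm]
      simp_rw [hcol]
      simp [sq]
    rw [h1, h2]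
    ring
  -- `Σ_{s,t} min ≥ R_k²`
  have hmin : ∀ k, R k ^ 2 ≤ ∑ s, ∑ t, min (A k s) (A k t) := fun k => by
    rw [sq, hR, Finset.sum_mul_sum]
    exact Finset.sum_le_sum fun s _ => Finset.sum_le_sum fun t _ =>
      mul_le_min_of_unit (hA k s) (hle1 k s) (hA k t) (hle1 k t)
  -- Cauchy–Schwarz over `s`
  have hCS : (m : ℝ) ^ 2 ≤ s.card * ∑ k, R k ^ 2 := by
    have h1 : ∑ k, R k = ∑ k ∈ s, R k * 1 := by
      rw [← Finset.sum_subset (Finset.subset_univ s) fun k _ hk => by rw [hRoff k hk]]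
      simp
    have h2 : ∑ k, R k ^ 2 = ∑ k ∈ s, R k ^ 2 :=
      (Finset.sum_subset (Finset.subset_univ s) fun k _ hk => by rw [hRoff k hk]; ring).symm
    have h3 := Finset.sum_mul_sq_le_sq_mul_sq s R (fun _ => (1 : ℝ))
    rw [← h1, hRsum] at h3
    simp only [one_pow, Finset.sum_const, nsmul_eq_mul, mul_one] at h3
    rw [h2]; linarith
  have hcard : (0 : ℝ) < s.card := by exact_mod_cast hsne.card_pos
  have hsum_ge : (m : ℝ) ^ 2 / s.card ≤ ∑ k, ∑ s, ∑ t, min (A k s) (A k t) := by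
    rw [div_le_iff₀ hcard]
    calc (m : ℝ) ^ 2 ≤ s.card * ∑ k, R k ^ 2 := hCS
      _ ≤ s.card * ∑ k, ∑ s, ∑ t, min (A k s) (A k t) :=
          mul_le_mul_of_nonneg_left (Finset.sum_le_sum fun k _ => hmin k) hcard.le
      _ = _ := mul_comm _ _
  rw [hw]
  have : 2 * (m : ℝ) ^ 2 * (1 - 1 / s.card) = 2 * (m : ℝ) ^ 2 - 2 * ((m : ℝ) ^ 2 / s.card) := by ring
  rw [this]
  linarith

/-- **Riazanov–Vyalyi Lemmas 4.3–4.4** (p07–p08: "there exists a stochastic matrix `M̃ ∈ ℝ^{r×m}` such that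
`S(M) ≤ S(M̃)`" by row elimination, and "`S(M̃) ≤ 1 − 1/r`"): for every column-stochastic `M` of rank `r`,
`Z(M) = ½ Σ_k w_k ≤ m²(1 − 1/r)`. [cite: RiazanovVyalyiy2017, Lemma 4.3 (p07) and Lemma 4.4 (p08)] -/
theorem RiazanovVyalyiy2017_lemma43_44 (M : Matrix (Fin n) (Fin m) ℝ) (hM : ∀ i j, 0 ≤ M i j)
    (hcol : ∀ j, ∑ i, M i j = 1) : ∑ k, rowL1Spread M k ≤ 2 * (m : ℝ) ^ 2 * (1 - 1 / M.rank) := by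
  classical
  rcases Nat.eq_zero_or_pos m with hm | hm
  · subst hm
    simp [rowL1Spread]
  suffices key : ∀ (k : ℕ) (A : Matrix (Fin n) (Fin m) ℝ), (∀ i j, 0 ≤ A i j) → (∀ j, ∑ i, A i j = 1) →
      (Finset.univ.filter fun i => A i ≠ 0).card ≤ k →
        ∑ k, rowL1Spread A k ≤ 2 * (m : ℝ) ^ 2 * (1 - 1 / A.rank) from key _ M hM hcol le_rfl
  intro k
  induction k with
  | zero =>
    intro A hA hAcol hcard
    exfalso
    have hzero : ∀ i, A i = 0 := fun i => by
      by_contra h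
      have : i ∈ Finset.univ.filter (fun i => A i ≠ 0) := by simp [h]
      rw [Nat.le_zero, Finset.card_eq_zero] at hcard
      rw [hcard] at this
      simp at this
    have h := hAcol ⟨0, hm⟩
    rw [Finset.sum_eq_zero fun i _ => by rw [hzero i]; rfl] at h
    exact zero_ne_one h
  | succ k ih =>
    intro A hA hAcol hcard
    set s : Finset (Fin n) := Finset.univ.filter fun i => A i ≠ 0 with hsdef
    have hs : ∀ i, i ∈ s ↔ A i ≠ 0 := fun i => by simp [hsdef]
    have hoff : ∀ i, i ∉ s → A i = 0 := fun i hi => by simpa [hs] using hi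
    have hsne : s.Nonempty := by
      by_contra h
      rw [Finset.not_nonempty_iff_eq_empty] at h
      have h0 := hAcol ⟨0, hm⟩
      rw [Finset.sum_eq_zero fun i _ => by rw [hoff i (by simp [h])]; rfl] at h0
      exact zero_ne_one h0
    have hrankpos : ∀ (B : Matrix (Fin n) (Fin m) ℝ), (∀ j, ∑ i, B i j = 1) → 0 < B.rank := by
      intro B hB
      refine rank_pos_of_ne_zero fun h0 => ?_
      have h := hB ⟨0, hm⟩
      rw [h0] at h
      simp at h
    by_cases hli : LinearIndependent ℝ (fun i : s => A i.1)
    · have hcard_le := card_le_rank_of_linearIndependent_rows A hli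
      have hspos : (0 : ℝ) < s.card := by exact_mod_cast hsne.card_pos
      calc ∑ k, rowL1Spread A k ≤ 2 * (m : ℝ) ^ 2 * (1 - 1 / s.card) :=
            sum_rowL1Spread_le_of_support A hA hAcol hoff hsne
        _ ≤ 2 * (m : ℝ) ^ 2 * (1 - 1 / A.rank) := by
            have : (1 : ℝ) / A.rank ≤ 1 / s.card :=
              one_div_le_one_div_of_le hspos (by exact_mod_cast hcard_le)
            nlinarith
    · obtain ⟨d, hd0, hdcol, hdobj, i₀, hi₀s, hdi₀⟩ := exists_rowElimination A hA hs hli (rowL1Spread A)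
      set A' : Matrix (Fin n) (Fin m) ℝ := Matrix.of fun i j => d i * A i j with hA'
      have hA'nn : ∀ i j, 0 ≤ A' i j := fun i j => mul_nonneg (hd0 i) (hA i j)
      have hA'col : ∀ j, ∑ i, A' i j = 1 := fun j => by
        simp only [hA', Matrix.of_apply]; rw [hdcol j, hAcol j]
      have hA'card : (Finset.univ.filter fun i => A' i ≠ 0).card ≤ k := by
        have hsub : (Finset.univ.filter fun i => A' i ≠ 0) ⊂ s := by
          rw [Finset.ssubset_iff_of_subset]
          · refine ⟨i₀, hi₀s, ?_⟩
            simp only [Finset.mem_filter, Finset.mem_univ, true_and, not_not]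
            funext j
            simp [hA', hdi₀]
          · intro i hi
            rw [Finset.mem_filter] at hi
            rw [hs]
            intro h0
            apply hi.2
            funext j
            simp [hA', h0]
        have := Finset.card_lt_card hsub
        omega
      have hrank : A'.rank ≤ A.rank := by
        have hmul : A' = Matrix.diagonal d * A := by
          ext i j; simp [hA', Matrix.diagonal_mul]
        rw [hmul]; exact Matrix.rank_mul_le_right _ _
      have hA'pos := hrankpos A' hA'col
      have hW : ∑ k, rowL1Spread A' k = ∑ k, d k * rowL1Spread A k :=
        Finset.sum_congr rfl fun k _ => rowL1Spread_rowScale A d hd0 k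
      calc ∑ k, rowL1Spread A k ≤ ∑ k, d k * rowL1Spread A k := hdobj
        _ = ∑ k, rowL1Spread A' k := hW.symm
        _ ≤ 2 * (m : ℝ) ^ 2 * (1 - 1 / A'.rank) := ih A' hA'nn hA'col hA'card
        _ ≤ 2 * (m : ℝ) ^ 2 * (1 - 1 / A.rank) := by
            have : (1 : ℝ) / A.rank ≤ 1 / A'.rank :=
              one_div_le_one_div_of_le (by exact_mod_cast hA'pos) (by exact_mod_cast hrank)
            nlinarith

/-- **The average fidelity of the columns is at least `1/rank`** (eq. (ko) of the printed proof:
`Σ_{s,t} F(M_s,M_t)/m² ≥ 1 − S(M) ≥ 1/r`, combining Lemma 4.1 with Lemmas 4.3–4.4).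
[cite: RiazanovVyalyiy2017, Thm. 4.2 proof (p07–p08)] -/
theorem sum_fidelity_ge_sq_div_rank (M : Matrix (Fin n) (Fin m) ℝ) (hM : ∀ i j, 0 ≤ M i j)
    (hcol : ∀ j, ∑ i, M i j = 1) :
    (m : ℝ) ^ 2 / M.rank ≤ ∑ s, ∑ t, classicalFidelity (fun k => M k s) (fun k => M k t) := by
  have h1 : ∑ s, ∑ t, (1 - colL1Dist M s t / 2) ≤
      ∑ s, ∑ t, classicalFidelity (fun k => M k s) (fun k => M k t) :=
    Finset.sum_le_sum fun s _ => Finset.sum_le_sum fun t _ => RiazanovVyalyiy2017_lemma41 M hM hcol s t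
  have h2 : ∑ s, ∑ t, (1 - colL1Dist M s t / 2) = (m : ℝ) ^ 2 - (∑ k, rowL1Spread M k) / 2 := by
    rw [← sum_colL1Dist_eq]
    simp only [Finset.sum_sub_distrib, Finset.sum_const, Finset.card_univ, Fintype.card_fin,
      nsmul_eq_mul, Finset.sum_div]
    ring
  have h3 := RiazanovVyalyiy2017_lemma43_44 M hM hcol
  have h4 : (m : ℝ) ^ 2 / M.rank = (m : ℝ) ^ 2 - (2 * (m : ℝ) ^ 2 * (1 - 1 / M.rank)) / 2 := by ring
  rw [h4]
  linarith

/-! ### Theorem 4.2 (`B₃ ≤ (ln m + 1)² r²`): Lemma 4.2 and the assembly -/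

/-- **Riazanov–Vyalyi Lemma 4.2** (p07, for `q_1 ≥ q_2 ≥ … ≥ q_m`: "There exists `s` such that
`s q_s ≥ 1/(ln m + 1)`"; proof: else `1 = Σ q < (1/(ln m+1))(1 + 1/2 + … + 1/m) < 1`). Typed without the
sorting convention: there is a nonempty set `T` of columns (the top `s`) on which `q ≥ 1/((ln m + 1)|T|)`.
[cite: RiazanovVyalyiy2017, Lemma 4.2 (p07)] -/
theorem RiazanovVyalyiy2017_lemma42 {m : ℕ} (q : Fin m → ℝ) (hq1 : ∑ j, q j = 1) :
    ∃ T : Finset (Fin m), T.Nonempty ∧ ∀ t ∈ T, 1 / ((Real.log m + 1) * T.card) ≤ q t := by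
  classical
  have hm : 1 ≤ m := by
    rcases Nat.eq_zero_or_pos m with h | h
    · subst h; simp at hq1
    · exact h
  set L : ℝ := Real.log m + 1 with hL
  have hL0 : 0 < L := by
    have : 0 ≤ Real.log m := Real.log_nonneg (by exact_mod_cast hm)
    linarith
  -- sort: `qs i = q (σ (rev i))` is antitone
  set σ : Equiv.Perm (Fin m) := Tuple.sort q with hσ
  let f : Fin m → Fin m := fun i => σ (Fin.rev i)
  have hf : Function.Injective f := fun i j h => Fin.rev_injective (σ.injective h)
  set qs : Fin m → ℝ := fun i => q (f i) with hqs
  have hanti : ∀ i j : Fin m, i ≤ j → qs j ≤ qs i := by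
    intro i j hij
    have hmono := Tuple.monotone_sort q (Fin.rev_le_rev.mpr hij)
    simpa [hqs, f, hσ, Function.comp] using hmono
  have hsum_qs : ∑ i, qs i = 1 := by
    rw [← hq1]
    exact Finset.sum_bij (fun i _ => f i) (fun _ _ => Finset.mem_univ _) (fun i _ j _ h => hf h)
      (fun j _ => ⟨Fin.rev (σ.symm j), Finset.mem_univ _, by simp [f]⟩) (fun _ _ => rfl)
  -- some `s` with `(s+1) qs s ≥ 1/L`
  have hex : ∃ s : Fin m, 1 / L ≤ ((s : ℕ) + 1) * qs s := by
    by_contra hall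
    push Not at hall
    have hlt : ∀ i : Fin m, qs i < 1 / L * (1 / ((i : ℕ) + 1)) := fun i => by
      have h := hall i
      have hpos : (0 : ℝ) < (i : ℕ) + 1 := by positivity
      rw [mul_one_div, lt_div_iff₀ hpos]
      linarith
    have hsum_lt : ∑ i, qs i < ∑ i : Fin m, 1 / L * (1 / ((i : ℕ) + 1)) :=
      Finset.sum_lt_sum_of_nonempty ⟨⟨0, hm⟩, Finset.mem_univ _⟩ fun i _ => hlt i
    rw [hsum_qs, ← Finset.mul_sum] at hsum_lt
    -- the harmonic number
    have hharm : ∑ i : Fin m, (1 : ℝ) / ((i : ℕ) + 1) = (harmonic m : ℝ) := by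
      rw [harmonic, Rat.cast_sum, Fin.sum_univ_eq_sum_range (fun i => (1 : ℝ) / (i + 1)) m]
      refine Finset.sum_congr rfl fun i _ => ?_
      push_cast
      ring
    rw [hharm] at hsum_lt
    have hbound := harmonic_le_one_add_log m
    have : 1 / L * (harmonic m : ℝ) ≤ 1 := by
      rw [one_div, inv_mul_le_iff₀ hL0, hL]
      linarith
    linarith
  obtain ⟨s0, hs0⟩ := hex
  refine ⟨(Finset.Iic s0).image f, ⟨f s0, Finset.mem_image.mpr ⟨s0, Finset.mem_Iic.mpr le_rfl, rfl⟩⟩,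
    fun t ht => ?_⟩
  rw [Finset.card_image_of_injective _ hf, Fin.card_Iic]
  obtain ⟨i, hi, rfl⟩ := Finset.mem_image.mp ht
  have hqi : qs s0 ≤ qs i := hanti i s0 (Finset.mem_Iic.mp hi)
  have hpos : (0 : ℝ) < (s0 : ℕ) + 1 := by positivity
  have h1 : 1 / (L * (((s0 : ℕ) + 1 : ℕ) : ℝ)) ≤ qs s0 := by
    push_cast
    rw [div_le_iff₀ (mul_pos hL0 hpos)]
    rw [div_le_iff₀ hL0] at hs0
    linarith
  exact h1.trans hqi

/-- Cauchy–Schwarz for a double sum: `(Σ_{i,i'} F)² ≤ c² Σ_{i,i'} F²`. [folklore] -/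
private theorem sq_sum_sum_le {c : ℕ} (F : Fin c → Fin c → ℝ) :
    (∑ i, ∑ i', F i i') ^ 2 ≤ (c : ℝ) ^ 2 * ∑ i, ∑ i', F i i' ^ 2 := by
  have h := Finset.sum_mul_sq_le_sq_mul_sq (Finset.univ : Finset (Fin c × Fin c))
    (fun p => F p.1 p.2) (fun _ => (1 : ℝ))
  simp only [mul_one, one_pow, Finset.sum_const, Finset.card_univ, Fintype.card_prod, Fintype.card_fin,
    nsmul_eq_mul] at h
  simp only [Fintype.sum_prod_type] at h
  calc (∑ i, ∑ i', F i i') ^ 2 ≤ (∑ i, ∑ i', F i i' ^ 2) * ((c * c : ℕ) : ℝ) := h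
    _ = (c : ℝ) ^ 2 * ∑ i, ∑ i', F i i' ^ 2 := by push_cast; ring

/-- **Riazanov–Vyalyi Theorem 4.2** (p07, verbatim: "Let `M ∈ ℝ^{n×m}` be a stochastic matrix,
`rank M = r`. Then `B₃(M) ≤ (ln m + 1)² r²`", `B₃(M) = max_q 1/Σ_{i,j} q_i q_j F(M_i,M_j)²`), typed as in the
tree's `LeeWeiDeWolf2017_thm19_real`: for every probability vector `q` on the columns,
`1 ≤ (ln m + 1)² r² · Σ_{s,t} q_s q_t F(M_s,M_t)²`. Printed proof: Lemma 4.2 picks the top-`s` columns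
`T` with `q ≥ 1/((ln m+1)s)` there; on `T`, RMS–AM and Lemma 4.1 with Lemmas 4.3–4.4 for the column
submatrix (rank `≤ r`) give `Σ_{T×T} F² ≥ s²/r²`. [cite: RiazanovVyalyiy2017, Thm. 4.2 (p07–p08)] -/
theorem RiazanovVyalyiy2017_thm42 (M : Matrix (Fin n) (Fin m) ℝ) (hM : ∀ i j, 0 ≤ M i j)
    (hcol : ∀ j, ∑ i, M i j = 1) (q : Fin m → ℝ) (hq : ∀ j, 0 ≤ q j) (hq1 : ∑ j, q j = 1) :
    (1 : ℝ) ≤ (Real.log m + 1) ^ 2 * (M.rank : ℝ) ^ 2 *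
      ∑ s, ∑ t, q s * q t * classicalFidelity (fun k => M k s) (fun k => M k t) ^ 2 := by
  classical
  have hm : 1 ≤ m := by
    rcases Nat.eq_zero_or_pos m with h | h
    · subst h; simp at hq1
    · exact h
  set L : ℝ := Real.log m + 1 with hL
  have hL0 : 0 < L := by
    have : 0 ≤ Real.log m := Real.log_nonneg (by exact_mod_cast hm); linarith
  obtain ⟨T, hTne, hT⟩ := RiazanovVyalyiy2017_lemma42 q hq1
  set c : ℕ := T.card with hc
  have hcpos : 0 < c := hTne.card_pos
  have hc0 : (0 : ℝ) < c := by exact_mod_cast hcpos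
  set θ : ℝ := 1 / (L * c) with hθ
  have hθ0 : 0 ≤ θ := by positivity
  -- the column submatrix on `T`, reindexed by `Fin c`
  let e : {t // t ∈ T} ≃ Fin c := T.equivFin
  let col : Fin c → Fin m := fun i => (e.symm i).1
  have hcolT : ∀ i, col i ∈ T := fun i => (e.symm i).2
  have hcol_inj : Function.Injective col := fun i j h => by
    have : e.symm i = e.symm j := Subtype.ext h
    exact e.symm.injective this
  set MT : Matrix (Fin n) (Fin c) ℝ := Matrix.of fun k i => M k (col i) with hMT
  have hMTnn : ∀ k i, 0 ≤ MT k i := fun k i => hM k (col i)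
  have hMTcol : ∀ i, ∑ k, MT k i = 1 := fun i => hcol (col i)
  -- `rank MT ≤ rank M`, `rank MT ≥ 1`
  have hrankle : MT.rank ≤ M.rank := by
    have hmul : MT = M * (Matrix.of fun j i => if j = col i then (1 : ℝ) else 0) := by
      ext k i
      rw [Matrix.mul_apply, Finset.sum_eq_single (col i)]
      · simp [hMT]
      · intro j _ hj; simp [hj]
      · intro h; exact absurd (Finset.mem_univ _) h
    rw [hmul]; exact Matrix.rank_mul_le_left _ _
  have hrankpos : 0 < MT.rank := by
    refine rank_pos_of_ne_zero fun h0 => ?_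
    have h := hMTcol ⟨0, hcpos⟩
    rw [h0] at h
    simp at h
  have hr0 : (0 : ℝ) < M.rank := by exact_mod_cast lt_of_lt_of_le hrankpos hrankle
  -- fidelity sums on `T`
  set F : Fin c → Fin c → ℝ := fun i i' => classicalFidelity (fun k => MT k i) (fun k => MT k i') with hF
  have hΦ : (c : ℝ) ^ 2 / M.rank ≤ ∑ i, ∑ i', F i i' := by
    have h1 := sum_fidelity_ge_sq_div_rank MT hMTnn hMTcol
    have h2 : (c : ℝ) ^ 2 / M.rank ≤ (c : ℝ) ^ 2 / MT.rank :=
      div_le_div_of_nonneg_left (by positivity) (by exact_mod_cast hrankpos) (by exact_mod_cast hrankle)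
    exact h2.trans h1
  have hΦ0 : 0 ≤ (c : ℝ) ^ 2 / M.rank := by positivity
  have hF2 : (c : ℝ) ^ 2 / (M.rank : ℝ) ^ 2 ≤ ∑ i, ∑ i', F i i' ^ 2 := by
    have hcs := sq_sum_sum_le F
    have hsq : ((c : ℝ) ^ 2 / M.rank) ^ 2 ≤ (∑ i, ∑ i', F i i') ^ 2 := pow_le_pow_left₀ hΦ0 hΦ 2
    have hc2 : (0 : ℝ) < (c : ℝ) ^ 2 := by positivity
    rw [div_le_iff₀ (by positivity)] at *
    -- `(c²/r)² ≤ c² Σ F²` gives `c²/r² ≤ Σ F²`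
    have h3 : ((c : ℝ) ^ 2 / M.rank) ^ 2 = (c : ℝ) ^ 2 / (M.rank : ℝ) ^ 2 * (c : ℝ) ^ 2 := by
      field_simp
    nlinarith [hcs, hsq, h3]
  -- restrict the quadratic form to `T × T` and bound `q ≥ θ` there
  have hterm_nn : ∀ s t, 0 ≤ q s * q t * classicalFidelity (fun k => M k s) (fun k => M k t) ^ 2 :=
    fun s t => mul_nonneg (mul_nonneg (hq s) (hq t)) (sq_nonneg _)
  have hrestrict : ∑ s ∈ T, ∑ t ∈ T, q s * q t * classicalFidelity (fun k => M k s) (fun k => M k t) ^ 2 ≤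
      ∑ s, ∑ t, q s * q t * classicalFidelity (fun k => M k s) (fun k => M k t) ^ 2 := by
    calc ∑ s ∈ T, ∑ t ∈ T, q s * q t * classicalFidelity (fun k => M k s) (fun k => M k t) ^ 2
        ≤ ∑ s ∈ T, ∑ t, q s * q t * classicalFidelity (fun k => M k s) (fun k => M k t) ^ 2 :=
          Finset.sum_le_sum fun s _ =>
            Finset.sum_le_univ_sum_of_nonneg fun t => hterm_nn s t
      _ ≤ _ := Finset.sum_le_univ_sum_of_nonneg fun s => Finset.sum_nonneg fun t _ => hterm_nn s t
  have hlower : θ ^ 2 * ∑ i, ∑ i', F i i' ^ 2 ≤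
      ∑ s ∈ T, ∑ t ∈ T, q s * q t * classicalFidelity (fun k => M k s) (fun k => M k t) ^ 2 := by
    -- reindex `T` by `Fin c`
    have hre : ∀ g : Fin m → ℝ, ∑ s ∈ T, g s = ∑ i : Fin c, g (col i) := by
      intro g
      rw [← Finset.sum_coe_sort T g]
      exact (Fintype.sum_equiv e.symm (fun i => g (col i)) (fun x => g x.1) fun i => rfl).symm
    rw [hre]
    simp_rw [hre]
    rw [Finset.mul_sum]
    refine Finset.sum_le_sum fun i _ => ?_
    rw [Finset.mul_sum]
    refine Finset.sum_le_sum fun i' _ => ?_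
    have hqi : θ ≤ q (col i) := hT _ (hcolT i)
    have hqi' : θ ≤ q (col i') := hT _ (hcolT i')
    have hFeq : F i i' = classicalFidelity (fun k => M k (col i)) (fun k => M k (col i')) := rfl
    rw [← hFeq]
    have : θ ^ 2 ≤ q (col i) * q (col i') := by
      rw [sq]; exact mul_le_mul hqi hqi' hθ0 (hq _)
    exact mul_le_mul_of_nonneg_right this (sq_nonneg _)
  -- combine: `θ² c²/r² = 1/(L² r²)`
  have hmain : 1 / (L ^ 2 * (M.rank : ℝ) ^ 2) ≤
      ∑ s, ∑ t, q s * q t * classicalFidelity (fun k => M k s) (fun k => M k t) ^ 2 := by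
    have h1 : 1 / (L ^ 2 * (M.rank : ℝ) ^ 2) = θ ^ 2 * ((c : ℝ) ^ 2 / (M.rank : ℝ) ^ 2) := by
      rw [hθ]; field_simp
    rw [h1]
    calc θ ^ 2 * ((c : ℝ) ^ 2 / (M.rank : ℝ) ^ 2) ≤ θ ^ 2 * ∑ i, ∑ i', F i i' ^ 2 :=
          mul_le_mul_of_nonneg_left hF2 (sq_nonneg _)
      _ ≤ _ := hlower.trans hrestrict
  have hpos : 0 < L ^ 2 * (M.rank : ℝ) ^ 2 := by positivity
  rw [div_le_iff₀ hpos] at hmain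
  linarith [hmain]

/-! ### Theorem 4.4 (`B₅ ≤ r²(ln m + 1)`) -/

/-- **Riazanov–Vyalyi Theorem 4.4** (p08, verbatim: "Let `M ∈ ℝ^{n×m}` be a stochastic matrix,
`rank M = r`. Then `B₅(M) ≤ r²(ln m + 1)`"; proof: the bound of Theorem 4.2 on each denominator of `B₅`,
then `Σ_k q_k^{(i)} M(i,k) ≤ max_k M(i,k)` and Theorem 4.3), typed as in the tree's
`LeeWeiDeWolf2017_thm29_real` with the maxima as arbitrary probability vectors `q i`:
`Σ_i (Σ_k q_{ik} M(i,k))/√(Σ_{s,t} q_{is} q_{it} F(M_s,M_t)²) ≤ (rank M)²(ln m + 1)`.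
[cite: RiazanovVyalyiy2017, Thm. 4.4 (p08)] -/
theorem RiazanovVyalyiy2017_thm44 (M : Matrix (Fin n) (Fin m) ℝ) (hM : ∀ i j, 0 ≤ M i j)
    (hcol : ∀ j, ∑ i, M i j = 1) (q : Fin n → Fin m → ℝ) (hq : ∀ i k, 0 ≤ q i k)
    (hq1 : ∀ i, ∑ k, q i k = 1) :
    ∑ i, (∑ k, q i k * M i k) /
        Real.sqrt (∑ s, ∑ t, q i s * q i t * classicalFidelity (fun k => M k s) (fun k => M k t) ^ 2) ≤
      (M.rank : ℝ) ^ 2 * (Real.log m + 1) := by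
  classical
  rcases Nat.eq_zero_or_pos n with hn | hn
  · subst hn
    simp only [Finset.univ_eq_empty, Finset.sum_empty]
    positivity
  have hm : 1 ≤ m := by
    rcases Nat.eq_zero_or_pos m with h | h
    · subst h; have := hq1 ⟨0, hn⟩; simp at this
    · exact h
  set L : ℝ := Real.log m + 1 with hL
  have hL0 : 0 < L := by
    have : 0 ≤ Real.log m := Real.log_nonneg (by exact_mod_cast hm); linarith
  set r : ℝ := (M.rank : ℝ) with hr
  have hr0 : 0 ≤ r := Nat.cast_nonneg _
  -- a column selection realising `max_k M(i,k)`
  have hne : (Finset.univ : Finset (Fin m)).Nonempty := Finset.univ_nonempty_iff.mpr ⟨⟨0, hm⟩⟩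
  choose c _ hc using fun i => Finset.exists_max_image Finset.univ (M i) hne
  -- each term is at most `L r · M(i, c i)`
  have hterm : ∀ i, (∑ k, q i k * M i k) /
      Real.sqrt (∑ s, ∑ t, q i s * q i t * classicalFidelity (fun k => M k s) (fun k => M k t) ^ 2) ≤
      L * r * M i (c i) := by
    intro i
    set Q : ℝ := ∑ s, ∑ t, q i s * q i t * classicalFidelity (fun k => M k s) (fun k => M k t) ^ 2 with hQ
    have hQ1 : 1 ≤ L ^ 2 * r ^ 2 * Q := RiazanovVyalyiy2017_thm42 M hM hcol (q i) (hq i) (hq1 i)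
    have hLr : 0 < L * r := by
      rcases hr0.eq_or_lt with h0 | hpos
      · exfalso; rw [← h0] at hQ1; simp at hQ1; linarith
      · exact mul_pos hL0 hpos
    have hQpos : 0 < Q := by
      by_contra hle
      have hQ0 : Q ≤ 0 := not_lt.mp hle
      have : L ^ 2 * r ^ 2 * Q ≤ 0 := mul_nonpos_of_nonneg_of_nonpos (by positivity) hQ0
      linarith
    -- `√Q ≥ 1/(L r)`
    have hsqrt : 1 / (L * r) ≤ Real.sqrt Q := by
      rw [Real.le_sqrt (by positivity) hQpos.le]
      rw [div_pow, one_pow, div_le_iff₀ (by positivity)]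
      nlinarith
    have hN0 : 0 ≤ ∑ k, q i k * M i k := Finset.sum_nonneg fun k _ => mul_nonneg (hq i k) (hM i k)
    have hNle : ∑ k, q i k * M i k ≤ M i (c i) := by
      calc ∑ k, q i k * M i k ≤ ∑ k, q i k * M i (c i) :=
            Finset.sum_le_sum fun k _ => mul_le_mul_of_nonneg_left (hc i k (Finset.mem_univ _)) (hq i k)
        _ = M i (c i) := by rw [← Finset.sum_mul, hq1 i, one_mul]
    calc (∑ k, q i k * M i k) / Real.sqrt Q ≤ (∑ k, q i k * M i k) / (1 / (L * r)) :=
          div_le_div_of_nonneg_left hN0 (by positivity) hsqrt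
      _ = L * r * ∑ k, q i k * M i k := by field_simp
      _ ≤ L * r * M i (c i) := mul_le_mul_of_nonneg_left hNle hLr.le
  have hB4 : ∑ i, M i (c i) ≤ r := RiazanovVyalyiy2017_thm43 M hM hcol c
  calc ∑ i, (∑ k, q i k * M i k) /
        Real.sqrt (∑ s, ∑ t, q i s * q i t * classicalFidelity (fun k => M k s) (fun k => M k t) ^ 2)
      ≤ ∑ i, L * r * M i (c i) := Finset.sum_le_sum fun i _ => hterm i
    _ = L * r * ∑ i, M i (c i) := by rw [Finset.mul_sum]
    _ ≤ L * r * r := mul_le_mul_of_nonneg_left hB4 (mul_nonneg hL0.le hr0)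
    _ = r ^ 2 * L := by ring

/-! ### The consequence for slack matrices of polytopes (§1, p03) -/

/-- Column scaling by positive weights does not change the rank. [folklore] -/
private theorem rank_colScale_eq {v f : ℕ} (S : Matrix (Fin v) (Fin f) ℝ) (w : Fin f → ℝ)
    (hw : ∀ j, 0 < w j) : (Matrix.of fun i j => S i j * w j).rank = S.rank := by
  have hmul : (Matrix.of fun i j => S i j * w j) = S * Matrix.diagonal w := by
    ext i j; simp [Matrix.mul_diagonal]
  have hunit : IsUnit (Matrix.diagonal w).det := by
    rw [Matrix.det_diagonal]
    exact isUnit_iff_ne_zero.mpr (Finset.prod_ne_zero_iff.mpr fun j _ => (hw j).ne')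
  rw [hmul, Matrix.rank_mul_eq_left_of_isUnit_det _ _ hunit]

/-- **Riazanov–Vyalyi, the conclusion for polytopes** (p03, verbatim: "We show that these functionals
cannot give exponential bounds on the PSD-rank … the bounding functionals of the slack matrix are bounded
above by the polynomial of the regular rank of this matrix and the logarithm of the matrix size. Since for
any polytope `P` we have `rank S_P = dim(P) + 1`, it would mean that the bounds are polynomial in the
dimension of the polytope."), `B₄`: for the slack matrix `S_P` of a `V`/`H`-described polytope of
dimension `n ≥ 1`, normalised to a column-stochastic `P(i,j) = S_P(i,j)w_j` (`w_j > 0`), every selection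
`c` has `Σ_i P(i, c_i) ≤ n + 1` (Theorem 4.3 with `rank S_P = n + 1`, the tree's
`rank_pairSlackMatrix_eq_finrank_add_one`). [cite: RiazanovVyalyiy2017, §1 (p03) with Thm. 4.3 (p08)] -/
theorem RiazanovVyalyiy2017_slack_B4 {d v f n : ℕ} (x : Fin v → (Fin d → ℝ)) (a : Fin f → (Fin d → ℝ))
    (b : Fin f → ℝ) (hn : 1 ≤ n) (hdim : Module.finrank ℝ (vectorSpan ℝ (Set.range x)) = n)
    (hP : convexHull ℝ (Set.range x) = {y | ∀ j, a j ⬝ᵥ y ≤ b j})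
    (w : Fin f → ℝ) (hw : ∀ j, 0 < w j) (hcol : ∀ j, ∑ i, pairSlackMatrix x a b i j * w j = 1)
    (c : Fin v → Fin f) : ∑ i, pairSlackMatrix x a b i (c i) * w (c i) ≤ n + 1 := by
  have hxQ : ∀ i j, a j ⬝ᵥ x i ≤ b j := fun i j => by
    have hi : x i ∈ {y : Fin d → ℝ | ∀ j, a j ⬝ᵥ y ≤ b j} := by
      rw [← hP]; exact subset_convexHull ℝ _ (Set.mem_range_self i)
    exact hi j
  set M : Matrix (Fin v) (Fin f) ℝ := Matrix.of fun i j => pairSlackMatrix x a b i j * w j with hM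
  have hMnn : ∀ i j, 0 ≤ M i j := fun i j => mul_nonneg (pairSlackMatrix_nonneg hxQ i j) (hw j).le
  have hMcol : ∀ j, ∑ i, M i j = 1 := fun j => by simpa [hM] using hcol j
  have hrank : M.rank = n + 1 := by
    rw [hM, rank_colScale_eq _ _ hw]
    exact rank_pairSlackMatrix_eq_finrank_add_one x a b hn hdim hP
  have h := RiazanovVyalyiy2017_thm43 M hMnn hMcol c
  rw [hrank] at h
  simpa [hM] using h

/-- The same conclusion for `B₂`: for the joint distribution `P(i,j)/f` obtained from the column-normalised
slack matrix of an `n`-dimensional polytope with `f` facet inequalities, `I ≤ log(n + 1)`.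
[cite: RiazanovVyalyiy2017, §1 (p03) with Thm. 4.1 (p06)] -/
theorem RiazanovVyalyiy2017_slack_B2 {d v f n : ℕ} (x : Fin v → (Fin d → ℝ)) (a : Fin f → (Fin d → ℝ))
    (b : Fin f → ℝ) (hn : 1 ≤ n) (hdim : Module.finrank ℝ (vectorSpan ℝ (Set.range x)) = n)
    (hP : convexHull ℝ (Set.range x) = {y | ∀ j, a j ⬝ᵥ y ≤ b j})
    (w : Fin f → ℝ) (hw : ∀ j, 0 < w j) (hcol : ∀ j, ∑ i, pairSlackMatrix x a b i j * w j = 1)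
    (hf : 1 ≤ f) :
    mutualInfo (Matrix.of fun i j => pairSlackMatrix x a b i j * w j / f) ≤ Real.log (n + 1) := by
  have hxQ : ∀ i j, a j ⬝ᵥ x i ≤ b j := fun i j => by
    have hi : x i ∈ {y : Fin d → ℝ | ∀ j, a j ⬝ᵥ y ≤ b j} := by
      rw [← hP]; exact subset_convexHull ℝ _ (Set.mem_range_self i)
    exact hi j
  have hf0 : (0 : ℝ) < f := by exact_mod_cast hf
  set M : Matrix (Fin v) (Fin f) ℝ := Matrix.of fun i j => pairSlackMatrix x a b i j * w j / f with hM
  have hMnn : ∀ i j, 0 ≤ M i j := fun i j =>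
    div_nonneg (mul_nonneg (pairSlackMatrix_nonneg hxQ i j) (hw j).le) hf0.le
  have hMsum : ∑ i, ∑ j, M i j = 1 := by
    rw [Finset.sum_comm]
    have : ∀ j, ∑ i, M i j = 1 / f := fun j => by
      simp only [hM, Matrix.of_apply]
      rw [← Finset.sum_div, hcol j]
    simp only [this, Finset.sum_const, Finset.card_univ, Fintype.card_fin, nsmul_eq_mul]
    field_simp
  have hrank : M.rank = n + 1 := by
    have e : M = Matrix.of fun i j => pairSlackMatrix x a b i j * (w j / f) := by
      ext i j; simp [hM, mul_div_assoc]
    rw [e, rank_colScale_eq _ _ fun j => div_pos (hw j) hf0]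
    exact rank_pairSlackMatrix_eq_finrank_add_one x a b hn hdim hP
  have h := RiazanovVyalyiy2017_thm41 M hMnn hMsum
  rw [hrank] at h
  exact_mod_cast h

/-- The same conclusion for `B₃`: for the column-normalised slack matrix `P` of an `n`-dimensional
polytope with `f` facet inequalities and every probability vector `q`,
`1 ≤ (ln f + 1)²(n + 1)² Σ_{s,t} q_s q_t F(P_s,P_t)²`, i.e. `B₃(P) ≤ (ln f + 1)²(n+1)²`.
[cite: RiazanovVyalyiy2017, §1 (p03) with Thm. 4.2 (p07)] -/
theorem RiazanovVyalyiy2017_slack_B3 {d v f n : ℕ} (x : Fin v → (Fin d → ℝ)) (a : Fin f → (Fin d → ℝ))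
    (b : Fin f → ℝ) (hn : 1 ≤ n) (hdim : Module.finrank ℝ (vectorSpan ℝ (Set.range x)) = n)
    (hP : convexHull ℝ (Set.range x) = {y | ∀ j, a j ⬝ᵥ y ≤ b j})
    (w : Fin f → ℝ) (hw : ∀ j, 0 < w j) (hcol : ∀ j, ∑ i, pairSlackMatrix x a b i j * w j = 1)
    (q : Fin f → ℝ) (hq : ∀ j, 0 ≤ q j) (hq1 : ∑ j, q j = 1) :
    (1 : ℝ) ≤ (Real.log f + 1) ^ 2 * ((n : ℝ) + 1) ^ 2 *
      ∑ s, ∑ t, q s * q t * classicalFidelity (fun k => pairSlackMatrix x a b k s * w s)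
        (fun k => pairSlackMatrix x a b k t * w t) ^ 2 := by
  have hxQ : ∀ i j, a j ⬝ᵥ x i ≤ b j := fun i j => by
    have hi : x i ∈ {y : Fin d → ℝ | ∀ j, a j ⬝ᵥ y ≤ b j} := by
      rw [← hP]; exact subset_convexHull ℝ _ (Set.mem_range_self i)
    exact hi j
  set M : Matrix (Fin v) (Fin f) ℝ := Matrix.of fun i j => pairSlackMatrix x a b i j * w j with hM
  have hMnn : ∀ i j, 0 ≤ M i j := fun i j => mul_nonneg (pairSlackMatrix_nonneg hxQ i j) (hw j).le
  have hMcol : ∀ j, ∑ i, M i j = 1 := fun j => by simpa [hM] using hcol j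
  have hrank : M.rank = n + 1 := by
    rw [hM, rank_colScale_eq _ _ hw]
    exact rank_pairSlackMatrix_eq_finrank_add_one x a b hn hdim hP
  have h := RiazanovVyalyiy2017_thm42 M hMnn hMcol q hq hq1
  rw [hrank] at h
  simpa [hM] using h

/-- The same conclusion for `B₅`: `Σ_i (Σ_k q_{ik} P(i,k))/√(Σ_{s,t} q_{is}q_{it}F(P_s,P_t)²) ≤ (n+1)²(ln f + 1)`
for the column-normalised slack matrix of an `n`-dimensional polytope with `f` facet inequalities.
[cite: RiazanovVyalyiy2017, §1 (p03) with Thm. 4.4 (p08)] -/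
theorem RiazanovVyalyiy2017_slack_B5 {d v f n : ℕ} (x : Fin v → (Fin d → ℝ)) (a : Fin f → (Fin d → ℝ))
    (b : Fin f → ℝ) (hn : 1 ≤ n) (hdim : Module.finrank ℝ (vectorSpan ℝ (Set.range x)) = n)
    (hP : convexHull ℝ (Set.range x) = {y | ∀ j, a j ⬝ᵥ y ≤ b j})
    (w : Fin f → ℝ) (hw : ∀ j, 0 < w j) (hcol : ∀ j, ∑ i, pairSlackMatrix x a b i j * w j = 1)
    (q : Fin v → Fin f → ℝ) (hq : ∀ i k, 0 ≤ q i k) (hq1 : ∀ i, ∑ k, q i k = 1) :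
    ∑ i, (∑ k, q i k * (pairSlackMatrix x a b i k * w k)) /
        Real.sqrt (∑ s, ∑ t, q i s * q i t * classicalFidelity (fun k => pairSlackMatrix x a b k s * w s)
          (fun k => pairSlackMatrix x a b k t * w t) ^ 2) ≤ ((n : ℝ) + 1) ^ 2 * (Real.log f + 1) := by
  have hxQ : ∀ i j, a j ⬝ᵥ x i ≤ b j := fun i j => by
    have hi : x i ∈ {y : Fin d → ℝ | ∀ j, a j ⬝ᵥ y ≤ b j} := by
      rw [← hP]; exact subset_convexHull ℝ _ (Set.mem_range_self i)
    exact hi j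
  set M : Matrix (Fin v) (Fin f) ℝ := Matrix.of fun i j => pairSlackMatrix x a b i j * w j with hM
  have hMnn : ∀ i j, 0 ≤ M i j := fun i j => mul_nonneg (pairSlackMatrix_nonneg hxQ i j) (hw j).le
  have hMcol : ∀ j, ∑ i, M i j = 1 := fun j => by simpa [hM] using hcol j
  have hrank : M.rank = n + 1 := by
    rw [hM, rank_colScale_eq _ _ hw]
    exact rank_pairSlackMatrix_eq_finrank_add_one x a b hn hdim hP
  have h := RiazanovVyalyiy2017_thm44 M hMnn hMcol q hq hq1
  rw [hrank] at h
  simpa [hM] using h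

end RowElimination

end Literature.Combinatorics.Optimization
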